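import Summits.QuantumFields.BalabanUV.T4Continuum.Spine.NE1p.DressedSmallFieldNestedToriTowerFamily
import Summits.QuantumFields.BalabanUV.T4Continuum.Spine.NE1p.DressedSmallFieldComponentInnerMuNestedTori
import Summits.QuantumFields.BalabanUV.T4Continuum.Spine.NE1p.DressedSmallFieldPencilInjective

/-!
# T⁴ programme, spine estimate NE1′ (node O3b/H2) — THE μ-PART RATE FAMILY ON THE TOWER: S57 §1's μ-END FIRES ON W75's DATUM AT
# EVERY OUTER RATE `r₁ ∈ [0, 1]` WITH W94's ONE-PARAMETER LETTERS — closed bound `(K₀(64,8)∕2)·e^{−6r₁}·μ₀∕(2 − μ₀)`; the family AT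
# `r₁ = ½` IS W75's activity BY THEOREM (so W85's μ-END and W75 P2's table END are its members at `½`); μ-liveness at every rate and
# every real source `t ∈ (0, 2]` — and (v1.2) every NON-REAL source of a sub-disc, via W100's pencil injectivity; LOCATED: the `4∕3` threshold
# is RATE-FREE, and THE RATE BUYS SOURCE WINDOW

Cell `pub-balaban`, sub-cell `t4`, BINDER-OWNERS row NE1′; crew `b2b-balaban-t4-ne1p-formalise-*`, row **W97 ∕ DAG N29zzzzzl** of
`t4/formal/NE1p/LEAVES.md` (INTENT `HOME/CLAIMS.log` l.24678, PROTOTYPE + STAGED l.24759; BOOKED typer RULING R-T153 l.24791 — kernel lane, ONE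
slot at PROPOSED, cap 340; read token X242; **v1.2**: INTENT + STAGED l.25429, BOOKED typer RULING R-T156 l.25520 — cap 400, kernel lane, ONE slot;
delta read X257), unit `b2b-balaban-t4-ne1p-formalise-leaf-10` (gen 13).  A FOLLOWER ON TWO LANDED WITNESS MODULES —
imports W94 `Spine/NE1p/DressedSmallFieldNestedToriTowerFamily` (p243849; → W75 P1∕P2∕P3: the tower, `CR`,
`termsT`, `GT`∕`cT`∕`majT`∕`actT`, `hadm_T`; W94: the letters `vF`∕`RkpF`∕`A₁F`, `majF`∕`cF`∕`GF`∕`actF`, `hrate_F`∕`hRR_F`∕`hsmall_F`∕`hAmp_F`,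
`letters_half`, `actF_CR`, `actF_of_ne`, `norm_actF_CR_lt_one`, `massF_pos`; W72 P2's `exp_locE_of_support_single`) and crew S57
`Spine/NE1p/DressedSmallFieldComponentInnerMuNestedTori` (p240443, leaf-01 g15; §1 = THE μ-END with generic inner data) and — v1.2 — W100 PART 1
`Spine/NE1p/DressedSmallFieldPencilInjective` (p244860, leaf-09 g15: `pencil`, `pencil_injOn`) ONLY, and re-enters W75's namespace; THEOREMS ONLY (0 def, 0 `def … : Prop`, 0 cite, 0 sorry, 0 `attribute`) + `example`s; S57 §1's END applied EXACTLY ONCE BY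
NAME (`towerMuEnd_fires_family`, `r₁` a VARIABLE); nothing of S57 ∕ S44 ∕ W75 ∕ W85 ∕ W94 ∕ W72 ∕ W59 ∕ W67 ∕ W33 restated.

WHY.  W85 fired S57 §1 (the μ-side of the (B3-count) chain on the nested tori) on W75's datum at the ONE rate `r₁ = ½`; W94 then typed
the TABLE side at every admissible outer rate `r₁ ∈ [0, 1]` with one-parameter letters.  THIS FILE is the μ-side of W94 exactly as W85
was the μ-side of W75:
* §0 **THE FAMILY AT `½` IS W75's ACTIVITY, BY THEOREM** — `majF_half`, `cF_half`, `GF_half`, **`actF_half : actF L M (1∕2) r hr = actT L M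
  r hr`**: W94's `letters_half` LIFTED from the three letters to the majorants, the Cauchy weights, the cores and the activity FUNCTION.
  Hence W85's μ-END and W75 P2's table END ARE the family's members at `½` — shown as two `example`s that re-derive their conclusions
  from the family ENDs through `actF_half` (a consistency check; neither is restated as a theorem);
* §1 **`towerMuEnd_fires_family (h0 : 0 ≤ r₁) (h1 : r₁ ≤ 1) (hμ0 : 0 < μ₀) (hμ2 : μ₀ < 2) (hμ : ‖sμ‖ ≤ μ₀)`** — S57 §1 ONCE at `(L, N′) :=
  (L, L·M)`, `X₀ := CR L M`, cores `GF`, index `termsT`, activity `actF … k` read along the SOURCE pencil `sμ ↦ 0 + sμ • liveTable`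
  (`v := liveTable`, `μ₁ := 2`), `A := 0 + 2·A₁F r₁` (so `hsmall` IS W94's `hsmall_F` and `hAmp` IS W94's `hAmp_F`, BY NAME), `hrate_F`,
  `hRR_F` at `vW := vF r₁`, `hadm_T`, W59.1's clauses; conclusion LITERAL with the factors `exp (−(r₁ · torusTreeLen (CR L M).1))` and
  `μ₀∕(2 − μ₀)`; **`towerMuEnd_fires_family_closed : … ≤ (K₀(64,8)∕2)·e^{−6r₁}·μ₀∕(2 − μ₀)`** (`torusTreeLen_CR = 1`); strictly
  decreasing in the rate, strictly increasing in the window radius;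
* §2 **μ-LIVENESS AT EVERY RATE FOR EVERY REAL SOURCE `0 < t ≤ 2`** — `exp_locE_actF` (W72 P2's `exp_locE_of_support_single` + W94's
  `norm_actF_CR_lt_one`), `actF_real_sub_zero` (W41's `closedForm_real_sub_zero`), **`towerMuEnd_family_live`** (W33's
  `integral_incr_pos` at `t·r > 0`): the μ-END's bounded quantity vanishes NOWHERE in the punctured real window, at every rate incl. `1`;
* §3 LOCATED (our bound SHAPES only): **`muFamilyBound_le_tableFamilyBound_iff`** — the family's μ-bound is below W94's table bound
  `K₀e^{−6r₁}` iff `μ₀ ≤ 4∕3`, UNIFORMLY in `r₁` (W85 §3's threshold is rate-free: the common factor `e^{−6r₁}` cancels);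
  **`rate_buys_window_iff`** — the family's μ-bound at rate `r₁` and radius `μ₀` is below W85's number `(K₀∕2)e^{−3}` (its bound at
  `r₁ = ½`, radius `1`) iff `μ₀·(1 + e^{6r₁−3}) ≤ 2·e^{6r₁−3}`: at `r₁ = ½` the window is `μ₀ ≤ 1` (`window_at_half_iff`), at `r₁ = 1`
  it contains `19∕10` (`window_at_one`, via `nineteen_lt_exp_three : 19 < e³`) — paying outer rate widens the admissible source disc
  towards (never up to) the full radius `2`; beyond `r₁ = 1` there is nothing to pay with at `R = RN` (W94's `rate_le_one_of_letters`);
  closing `example` at `(L, r₁) = (5, 1)`: W85's number reached at source radius `19∕10` ∧ liveness at `t = 19∕10`.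
* §4 (v1.2, APPEND-ONLY — §0–§3 byte-identical to v1.1 p244525) **COMPLEX-SOURCE LIVENESS**: `actF_CR_eq_pencil` (the family's activity at the rod IS
  `c·pencil r s`, W100's one-cube pencil term, by `rfl`), **`towerMuEnd_family_live_complex`** (`0 < r`, `2ρr < 1`, `ρ ≤ 2`, `s ≠ s′` in the disc ⇒
  `E_{act s}(C_R) ≠ E_{act s′}(C_R)` at every rate `0 ≤ r₁ ≤ 1` — W100's `pencil_injOn` BY NAME), `towerMuEnd_family_eq_iff`, and a decided `example`: at
  `(L, r₁, r) = (5, 1, ¼)` the μ-END's bound holds at the NON-REAL source `I` AND its quantity is live there (my X223∕X242 readers fired the bound at `I`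
  and `(3∕2)·I` precisely where §2's real-pair liveness said nothing).

HONEST FRAMING.  A DECIDED TOY — W75's datum with W94's one-parameter RE-CHOSEN letters read along the source pencil, S57 §1 composed BY
NAME ([folklore]∕[arith]); every numeral OURS in S44's∕S57's literal currency; `hinner` CHOSEN (W59's `mN`); (B1b) NOT claimed; (B3-amp)
MET by CHOSEN weights — UNPRINTED for Bałaban's cores (G-ne9p2-5); «the rate buys window» and the `4∕3` are facts about OUR two bound
SHAPES on a toy priced by exponentially smaller letters — NOTHING about slack on Bałaban's densities and nothing about print; no numeral
of [Balaban1988RGII]∕[Balaban1987RGI] asserted ((2.35)–(2.41), «L odd > 11» TYPE only); WHICH tori are Bałaban's = pv22's READING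
(D-pv22.3); 0 binders instantiated on Bałaban's densities; no wall item; wall v1.8 (T4-DAG v48∕v49∕v51) — words, not kind — does NOT
move; R-t4r2-Q2 NOT met; NE1′ ⇐ the named binders — NOT proved, NOT printed; spine PROVED 0∕9; count 9 unchanged; ABSOLUTE RULE
honoured.  Rung (B)+1 on ONE finite four-torus — NOT infinite volume, NOT a mass gap, NOT OS on ℝ⁴, NOT Clay.  HONEST DEPENDENCY:
continuum YM on T⁴ ⇐ BetaPertH ∧ nine spine estimates (0/9 proved); BetaPertH ⇐ (D1) ∧ (D4) ∧ CAP+tail; G-an2-4 gates asym, D1 and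
NE2/3/4.
-/

noncomputable section

namespace Summit.QuantumFields.BalabanUV.T4Continuum.NE1p.DressedSmallFieldNestedToriTower

open Set Metric MeasureTheory Complex
open scoped BigOperators
open Literature.MathematicalPhysics.QuantumFieldTheory.Balaban1983to89
open Literature.MathematicalPhysics.QuantumFieldTheory.Balaban1983to89.B12TreeDecay (K₀ K₀_pos)
open Literature.MathematicalPhysics.QuantumFieldTheory.Balaban1983to89.B13Resummation (locE)
open Literature.MathematicalPhysics.QuantumFieldTheory.Balaban1983to89.TreeLengthTorus (TDom tsys torusTreeLen)
open Literature.MathematicalPhysics.QuantumFieldTheory.Balaban1983to89.TreeLengthTorusGeometry (TTouch ttouch_symm)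
open Summit.QuantumFields.BalabanUV.T4Continuum.B13HistMeasurable (B13HistM)
open Summit.QuantumFields.BalabanUV.T4Continuum.B13HistWitness (toyFrame)
open Summit.QuantumFields.BalabanUV.T4Continuum.NE1p.DressedSmallFieldCoresWitness (E1 crd liveTable norm_liveTable_le ctr0 hroom0
  Acst Acst_pos incr integral_incr_pos)
open Summit.QuantumFields.BalabanUV.T4Continuum.NE1p.DressedSmallFieldCoresMassWitness (cM cM_pos)
open Summit.QuantumFields.BalabanUV.T4Continuum.NE1p.DressedSmallFieldDepCoresWitness (closedForm_real_sub_zero)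
open Summit.QuantumFields.BalabanUV.T4Continuum.NE1p.DressedSmallFieldNestedToriWitness (rN RN R₀N εN εN_pos hκ_N_eq hrate2_N_eq
  hκR_N h229_N_eq mN mN_nonneg hinner_N_eq LabelN)
open Summit.QuantumFields.BalabanUV.T4Continuum.NE1p.DressedSmallFieldNestedToriRod (CR torusTreeLen_CR)
open Summit.QuantumFields.BalabanUV.T4Continuum.NE1p.DressedSmallFieldRodRateWitness (exp_locE_of_support_single)
open Summit.QuantumFields.BalabanUV.T4Continuum.NE1p.DressedSmallFieldComponentInnerMuNestedTori
  (muPart_locE_le_of_coresAt_pencil_components_nestedTori)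
open Summit.QuantumFields.BalabanUV.T4Continuum.NE1p.DressedSmallFieldPencilInjective (pencil pencil_injOn)

section MuFamily
variable (L M : ℕ) [NeZero L] [NeZero M] (r₁ : ℝ) (r : ℝ) (hr : 0 ≤ r)

/-! ## §0 THE FAMILY AT `r₁ = ½` IS W75's ACTIVITY — W94's `letters_half` lifted to the majorants, weights, cores and the activity -/

/-- The family's majorant at `½` is W75 P2's `majT` (`vF (1∕2) = vT`, W94 `letters_half`). [arith] -/
theorem majF_half (l : LabelN L (L * M)) : majF L M (1 / 2) l = majT L M l := by
  unfold majF majT; rw [letters_half.1]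

/-- The family's Cauchy weight at `½` is W75 P2's `cT` (`e^{−5·½} = e^{−5∕2}`). [arith] -/
theorem cF_half (l : LabelN L (L * M)) : cF L M (1 / 2) r l = cT L M r l := by
  unfold cF cT; rw [majF_half]; norm_num

/-- The family's cores at `½` are W75 P2's `GT`. [arith] -/
theorem GF_half : GF L M (1 / 2) r hr = GT L M r hr := by
  funext k l X; rw [GF_apply, GT_apply, cF_half]

/-- **THE FAMILY AT `½` IS W75's ACTIVITY OF RECORD**: `actF L M (1∕2) r hr = actT L M r hr` as functions of `(k, s, Z)`. [arith] -/
theorem actF_half : actF L M (1 / 2) r hr = actT L M r hr := by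
  funext k s Z; unfold actF actT; rw [GF_half]

open Classical in
/-- **W75 P2's TABLE END IS THE FAMILY's MEMBER AT `½`** [decided toy]: its conclusion `≤ K₀(64,8)·e^{−3}` re-derived from W94's
`towerEnd_fires_family_closed` at `r₁ = ½` through `actF_half` (consistency check; W75 P2's `towerEnd_fires_closed` is NOT restated). -/
example (hL : 5 ≤ L) (k : ℕ) :
    ‖locE (TTouch (d := 4) (N := L * M)) (fun Z : (tsys 4 (L * M)).Dom => Z.1) (actT L M r hr k 1) (CR L M).1 -
        locE (TTouch (d := 4) (N := L * M)) (fun Z : (tsys 4 (L * M)).Dom => Z.1) (actT L M r hr k 0) (CR L M).1‖ ≤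
      K₀ 64 8 * Real.exp (-3) := by
  have h := towerEnd_fires_family_closed L M (1 / 2) r hr hL (by norm_num) (by norm_num) k
  have e : Real.exp (-(6 * (1 / 2 : ℝ))) = Real.exp (-3) := by norm_num
  rw [actF_half, e] at h
  exact h

/-! ## §1 THE μ-END FIRES ON THE TOWER AT EVERY OUTER RATE `r₁ ∈ [0, 1]` -/

open Classical in
/-- **S57 §1's `muPart_locE_le_of_coresAt_pencil_components_nestedTori` FIRES ON W75's TOWER DATUM AT EVERY OUTER RATE `0 ≤ r₁ ≤ 1`**
[decided toy]: coarse torus `tsys 4 (L·M)`, FINE torus `tsys 4 (L·(L·M))`, `X₀ := CR L M`, W94's cores `GF`∕index `termsT`∕activity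
`actF` BY NAME along the SOURCE pencil (`v := liveTable`, `μ₁ := 2`), `A := 0 + 2·A₁F r₁` (`hrate_F`, `hsmall_F`, `hRR_F` at
`vW := vF r₁`, `hAmp_F` — W94), `hadm_T` (W75 P1), W59.1's untouched clauses, `I := univ : Finset Unit`, `m := mN`; for `0 < μ₀ < 2` and
`‖sμ‖ ≤ μ₀`.  Conclusion LITERAL. [folklore] -/
theorem towerMuEnd_fires_family (hL : 5 ≤ L) (h0 : 0 ≤ r₁) (h1 : r₁ ≤ 1) (k : ℕ) {μ₀ : ℝ} {sμ : ℂ} (hμ0 : 0 < μ₀) (hμ2 : μ₀ < 2)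
    (hμ : ‖sμ‖ ≤ μ₀) :
    ‖locE (TTouch (d := 4) (N := L * M)) (fun Z : (tsys 4 (L * M)).Dom => Z.1) (actF L M r₁ r hr k sμ) (CR L M).1 -
        locE (TTouch (d := 4) (N := L * M)) (fun Z : (tsys 4 (L * M)).Dom => Z.1) (actF L M r₁ r hr k 0) (CR L M).1‖ ≤
      Real.exp 1 * 9 * 64 * K₀ 64 8 ^ 2 * (0 + 2 * A₁F r₁) * Real.exp (-(r₁ * torusTreeLen (CR L M).1)) * (μ₀ / (2 - μ₀)) :=
  have h3 : 3 ≤ L := by omega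
  muPart_locE_le_of_coresAt_pencil_components_nestedTori h3 (GF L M r₁ r hr)
    (Win := Set.univ) (ctr := ctr0) (ROp := fun _ => 1) (RHist := fun _ => 2) (R' := fun _ => 2)
    (mq := fun _ _ _ => 1) (bq := fun _ _ _ => 0) (N₀ := fun _ _ _ => 1)
    hroom0 (fun _ _ _ _ _ _ _ => one_pos)
    (fun _ _ _ _ _ _ _ => ⟨fun _ _ => aestronglyMeasurable_const, fun _ => differentiableOn_const _, fun _ _ _ => by
      show ‖(1 : ℂ)‖ ≤ 1; rw [norm_one]⟩)
    (fun _ _ _ _ _ _ _ => ⟨fun _ _ => (Complex.measurable_ofReal.comp (measurable_snd.norm.pow_const 2)).aestronglyMeasurable,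
      fun _ _ => differentiableOn_const _, fun _ _ _ v => by
        show 1 * ‖v‖ ^ 2 - 0 ≤ (((‖v‖ ^ 2 : ℝ) : ℂ)).re; rw [Complex.ofReal_re]; simp⟩)
    (g := fun _ => 0) (Set.mem_univ _) (U := ()) (o := 0) (h₀ := 0) (v := liveTable) (μ₁ := 2)
    (by show ‖(0 : ℂ) - 0‖ ≤ 1; simp)
    (by show ‖(0 : B13HistM toyFrame) - 0‖ + 2 * ‖liveTable‖ ≤ 2; rw [sub_zero, norm_zero, zero_add];
        linarith [norm_liveTable_le])
    (emb := fun _ => k) (fun _ => rfl) (terms := termsT L M) (act := actF L M r₁ r hr k) (fun _ _ _ => rfl)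
    (A := 0 + 2 * A₁F r₁) (r₁ := r₁) (CR L M) (sμ := sμ) (by have := A₁F_pos r₁; positivity) h0 (hrate_F r₁) (hsmall_F r₁)
    (fun _ => (Finset.univ : Finset Unit)) (mN L (L * M)) (mN_nonneg L (L * M))
    (ε := εN L) (c₀ := 0) (R₀ := R₀N L) (r := rN) (R := RN) (vW := vF r₁)
    (εN_pos L).le (vF_nonneg r₁ h1) (fun Z₀ => (hinner_N_eq L (L * M) Z₀).le) (hκR_N L h3) (hrate2_N_eq L h3).le hκ_N_eq.le
    (h229_N_eq L).le (hRR_F r₁) (hadm_T L M hL) (hAmp_F L M r₁ r hr h1 k) hμ0 hμ2 hμ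

open Classical in
/-- **… IN CLOSED FORM: `≤ (K₀(64,8)∕2)·e^{−6r₁}·μ₀∕(2 − μ₀)`** (`torusTreeLen_CR = 1`: `e·9·64·K₀²·(2·A·e^{−5r₁}∕4)·e^{−r₁} =
(K₀∕2)·e^{−6r₁}`); `r₁ = ½` gives W85's `(K₀∕2)·e^{−3}·μ₀∕(2 − μ₀)`. [folklore] -/
theorem towerMuEnd_fires_family_closed (hL : 5 ≤ L) (h0 : 0 ≤ r₁) (h1 : r₁ ≤ 1) (k : ℕ) {μ₀ : ℝ} {sμ : ℂ} (hμ0 : 0 < μ₀)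
    (hμ2 : μ₀ < 2) (hμ : ‖sμ‖ ≤ μ₀) :
    ‖locE (TTouch (d := 4) (N := L * M)) (fun Z : (tsys 4 (L * M)).Dom => Z.1) (actF L M r₁ r hr k sμ) (CR L M).1 -
        locE (TTouch (d := 4) (N := L * M)) (fun Z : (tsys 4 (L * M)).Dom => Z.1) (actF L M r₁ r hr k 0) (CR L M).1‖ ≤
      K₀ 64 8 / 2 * Real.exp (-(6 * r₁)) * (μ₀ / (2 - μ₀)) := by
  refine (towerMuEnd_fires_family L M r₁ r hr hL h0 h1 k hμ0 hμ2 hμ).trans (le_of_eq ?_)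
  rw [torusTreeLen_CR L M hL, mul_one]
  unfold A₁F Acst
  have hK := K₀_pos (64 : ℝ) 8
  have he := Real.exp_pos 1
  have h6 : Real.exp (-(5 * r₁)) * Real.exp (-r₁) = Real.exp (-(6 * r₁)) := by rw [← Real.exp_add]; ring_nf
  rw [← h6]
  field_simp
  ring

open Classical in
/-- **W85's μ-END IS THE FAMILY's MEMBER AT `½`** [decided toy]: its conclusion `≤ (K₀∕2)·e^{−3}·μ₀∕(2−μ₀)` for `actT` re-derived from
`towerMuEnd_fires_family_closed` at `r₁ = ½` through `actF_half` (consistency check; W85's `towerMuEnd_fires_closed` is NOT restated). -/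
example (hL : 5 ≤ L) (k : ℕ) {μ₀ : ℝ} {sμ : ℂ} (hμ0 : 0 < μ₀) (hμ2 : μ₀ < 2) (hμ : ‖sμ‖ ≤ μ₀) :
    ‖locE (TTouch (d := 4) (N := L * M)) (fun Z : (tsys 4 (L * M)).Dom => Z.1) (actT L M r hr k sμ) (CR L M).1 -
        locE (TTouch (d := 4) (N := L * M)) (fun Z : (tsys 4 (L * M)).Dom => Z.1) (actT L M r hr k 0) (CR L M).1‖ ≤
      K₀ 64 8 / 2 * Real.exp (-3) * (μ₀ / (2 - μ₀)) := by
  have h := towerMuEnd_fires_family_closed L M (1 / 2) r hr hL (by norm_num) (by norm_num) k hμ0 hμ2 hμ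
  have e : Real.exp (-(6 * (1 / 2 : ℝ))) = Real.exp (-3) := by norm_num
  rw [actF_half, e] at h
  exact h

/-- The closed μ-bound is STRICTLY DECREASING in the rate at fixed window. [arith] -/
theorem muFamily_closed_strictAnti {a b μ₀ : ℝ} (hab : a < b) (hμ0 : 0 < μ₀) (hμ2 : μ₀ < 2) :
    K₀ 64 8 / 2 * Real.exp (-(6 * b)) * (μ₀ / (2 - μ₀)) < K₀ 64 8 / 2 * Real.exp (-(6 * a)) * (μ₀ / (2 - μ₀)) := by
  have hK := K₀_pos (64 : ℝ) 8
  have hw : 0 < μ₀ / (2 - μ₀) := div_pos hμ0 (by linarith)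
  exact mul_lt_mul_of_pos_right (mul_lt_mul_of_pos_left (Real.exp_lt_exp.2 (by linarith)) (half_pos hK)) hw

/-- The closed μ-bound is STRICTLY INCREASING in the window radius at fixed rate (any `μ₀ < μ₀' < 2`; no sign needed). [arith] -/
theorem muFamily_closed_strictMono_window {μ₀ μ₀' : ℝ} (h : μ₀ < μ₀') (hμ2' : μ₀' < 2) :
    K₀ 64 8 / 2 * Real.exp (-(6 * r₁)) * (μ₀ / (2 - μ₀)) < K₀ 64 8 / 2 * Real.exp (-(6 * r₁)) * (μ₀' / (2 - μ₀')) := by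
  have hK := K₀_pos (64 : ℝ) 8
  have hpos : 0 < K₀ 64 8 / 2 * Real.exp (-(6 * r₁)) := mul_pos (half_pos hK) (Real.exp_pos _)
  refine mul_lt_mul_of_pos_left ?_ hpos
  rw [div_lt_div_iff₀ (by linarith) (by linarith)]
  nlinarith

/-! ## §2 μ-LIVENESS AT EVERY RATE, FOR EVERY REAL SOURCE IN THE PUNCTURED WINDOW `(0, 2]` -/

open Classical in
/-- `exp E_{act s}(C_R) = 1 + act s (C_R)` for `‖s‖ ≤ 2` (W72 P2's `exp_locE_of_support_single`; the activity lives on the rod only and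
stays inside the unit disc by W94's `norm_actF_CR_lt_one`). [folklore] -/
theorem exp_locE_actF (hL : 5 ≤ L) (h0 : 0 ≤ r₁) (h1 : r₁ ≤ 1) (k : ℕ) {s : ℂ} (hs : ‖s‖ ≤ 2) :
    cexp (locE (TTouch (d := 4) (N := L * M)) (fun Z : (tsys 4 (L * M)).Dom => Z.1) (actF L M r₁ r hr k s) (CR L M).1) =
      1 + actF L M r₁ r hr k s (CR L M) :=
  exp_locE_of_support_single (TTouch (d := 4) (N := L * M)) (fun _ _ h => ttouch_symm _ _ h)
    (fun Z : (tsys 4 (L * M)).Dom => Z.1) (actF L M r₁ r hr k s) rfl (fun _ _ hZ => actF_of_ne L M r₁ r hr hZ k s)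
    (norm_actF_CR_lt_one L M r₁ r hr hL h0 h1 k hs)

/-- The attached difference at a REAL source in closed form: `act t (C_R) − act 0 (C_R) = c·∫ incr (t·r)` with
`c = (cM r∕2)·e^{−5r₁}·(ε³ + v(r₁)³)` (W94's `actF_CR`, W41's `closedForm_real_sub_zero`). [folklore] -/
theorem actF_real_sub_zero (hL : 5 ≤ L) (k : ℕ) (t : ℝ) :
    actF L M r₁ r hr k (t : ℂ) (CR L M) - actF L M r₁ r hr k 0 (CR L M) =
      ((cM r / 2 * Real.exp (-(5 * r₁)) * (εN L ^ 3 + vF r₁ ^ 3) : ℝ) : ℂ) * ((∫ v, incr (t * r) v : ℝ) : ℂ) := by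
  rw [actF_CR L M r₁ r hr hL, actF_CR L M r₁ r hr hL]
  exact closedForm_real_sub_zero _ r hr t

open Classical in
/-- **THE μ-END's QUANTITY IS NOT ZERO AT ANY RATE `0 ≤ r₁ ≤ 1`** [decided toy]: for a REAL source `0 < t ≤ 2`,
`E_{act t}(C_R) ≠ E_{act 0}(C_R)` (`0 < r`; W33's `integral_incr_pos` at the rate `t·r > 0`, W94's `massF_pos`). [folklore] -/
theorem towerMuEnd_family_live (hL : 5 ≤ L) (h0 : 0 ≤ r₁) (h1 : r₁ ≤ 1) (hr0 : 0 < r) (k : ℕ) {t : ℝ} (ht0 : 0 < t)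
    (ht2 : t ≤ 2) :
    locE (TTouch (d := 4) (N := L * M)) (fun Z : (tsys 4 (L * M)).Dom => Z.1) (actF L M r₁ r hr k (t : ℂ)) (CR L M).1 ≠
      locE (TTouch (d := 4) (N := L * M)) (fun Z : (tsys 4 (L * M)).Dom => Z.1) (actF L M r₁ r hr k 0) (CR L M).1 := by
  intro h
  have ht : ‖(t : ℂ)‖ ≤ 2 := by rw [Complex.norm_real, Real.norm_eq_abs, abs_of_pos ht0]; exact ht2
  have h' := congrArg cexp h
  rw [exp_locE_actF L M r₁ r hr hL h0 h1 k ht, exp_locE_actF L M r₁ r hr hL h0 h1 k (by simp), add_right_inj] at h'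
  have hz := sub_eq_zero.2 h'
  rw [actF_real_sub_zero L M r₁ r hr hL] at hz
  have hc : 0 < cM r / 2 * Real.exp (-(5 * r₁)) * (εN L ^ 3 + vF r₁ ^ 3) :=
    mul_pos (mul_pos (half_pos (cM_pos r)) (Real.exp_pos _)) (massF_pos L r₁ h1)
  rcases mul_eq_zero.1 hz with hc0 | hI
  · exact hc.ne' (by exact_mod_cast hc0)
  · exact (integral_incr_pos (t * r) (mul_pos ht0 hr0)).ne' (by exact_mod_cast hI)

/-! ## §3 LOCATED: the `4∕3` threshold is RATE-FREE; THE RATE BUYS SOURCE WINDOW -/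

/-- **`μ-bound ≤ table bound ↔ μ₀ ≤ 4∕3`, AT EVERY RATE** [arith]: `(K₀∕2)·e^{−6r₁}·μ₀∕(2−μ₀) ≤ K₀·e^{−6r₁}` iff `μ₀ ≤ 4∕3`
(`0 < μ₀ < 2`) — W85 §3's threshold does not depend on `r₁` (the factor `e^{−6r₁}` is common to both SHAPES). [folklore] -/
theorem muFamilyBound_le_tableFamilyBound_iff {μ₀ : ℝ} (hμ0 : 0 < μ₀) (hμ2 : μ₀ < 2) :
    K₀ 64 8 / 2 * Real.exp (-(6 * r₁)) * (μ₀ / (2 - μ₀)) ≤ K₀ 64 8 * Real.exp (-(6 * r₁)) ↔ μ₀ ≤ 4 / 3 := by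
  have hK := K₀_pos (64 : ℝ) 8
  have he := Real.exp_pos (-(6 * r₁))
  have hd : 0 < 2 - μ₀ := by linarith
  have hKe : 0 < K₀ 64 8 * Real.exp (-(6 * r₁)) := mul_pos hK he
  have key : K₀ 64 8 / 2 * Real.exp (-(6 * r₁)) * (μ₀ / (2 - μ₀)) =
      (K₀ 64 8 * Real.exp (-(6 * r₁))) * (μ₀ / (2 * (2 - μ₀))) := by
    field_simp
  rw [key, mul_le_iff_le_one_right hKe, div_le_one (by positivity)]
  constructor <;> intro h <;> linarith

/-- **THE RATE BUYS SOURCE WINDOW** [arith]: the family's μ-bound at `(r₁, μ₀)` is below W85's number `(K₀∕2)·e^{−3}` (its bound at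
`r₁ = ½` and source radius `1`) iff `μ₀·(1 + e^{6r₁−3}) ≤ 2·e^{6r₁−3}`, i.e. iff `μ₀ ≤ 2e^{6r₁−3}∕(1 + e^{6r₁−3})` (`0 < μ₀ < 2`).
[folklore] -/
theorem rate_buys_window_iff {μ₀ : ℝ} (hμ0 : 0 < μ₀) (hμ2 : μ₀ < 2) :
    K₀ 64 8 / 2 * Real.exp (-(6 * r₁)) * (μ₀ / (2 - μ₀)) ≤ K₀ 64 8 / 2 * Real.exp (-3) ↔
      μ₀ * (1 + Real.exp (6 * r₁ - 3)) ≤ 2 * Real.exp (6 * r₁ - 3) := by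
  have hK := K₀_pos (64 : ℝ) 8
  have hE := Real.exp_pos (6 * r₁ - 3)
  have hd : 0 < 2 - μ₀ := by linarith
  have hpos : 0 < K₀ 64 8 / 2 * Real.exp (-3) := mul_pos (half_pos hK) (Real.exp_pos _)
  have hsplit : Real.exp (-(6 * r₁)) = Real.exp (-3) * (Real.exp (6 * r₁ - 3))⁻¹ := by
    rw [← Real.exp_neg, ← Real.exp_add]; ring_nf
  have key : K₀ 64 8 / 2 * Real.exp (-(6 * r₁)) * (μ₀ / (2 - μ₀)) =
      (K₀ 64 8 / 2 * Real.exp (-3)) * (μ₀ / (Real.exp (6 * r₁ - 3) * (2 - μ₀))) := by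
    rw [hsplit]; field_simp
  rw [key, mul_le_iff_le_one_right hpos, div_le_one (by positivity)]
  constructor <;> intro h <;> nlinarith

/-- At `r₁ = ½` the window of `rate_buys_window_iff` is EXACTLY `μ₀ ≤ 1` (W85's radius). [arith] -/
theorem window_at_half_iff {μ₀ : ℝ} :
    μ₀ * (1 + Real.exp (6 * (1 / 2 : ℝ) - 3)) ≤ 2 * Real.exp (6 * (1 / 2 : ℝ) - 3) ↔ μ₀ ≤ 1 := by
  have e : Real.exp (6 * (1 / 2 : ℝ) - 3) = 1 := by norm_num
  rw [e]; constructor <;> intro h <;> linarith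

/-- `19 < e³` (`e > 2.718281828`). [arith] -/
theorem nineteen_lt_exp_three : (19 : ℝ) < Real.exp 3 := by
  have h := Real.exp_one_gt_d9
  have h3 : Real.exp 3 = Real.exp 1 ^ 3 := by rw [← Real.exp_nat_mul]; norm_num
  have h2 : (2.7182818283 : ℝ) ^ 3 < Real.exp 1 ^ 3 := by gcongr
  have h19 : (19 : ℝ) < (2.7182818283 : ℝ) ^ 3 := by norm_num
  rw [h3]
  exact h19.trans h2

/-- **AT THE FULL RATE `r₁ = 1` THE WINDOW CONTAINS `19∕10`**: `(19∕10)·(1 + e³) ≤ 2·e³`. [arith] -/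
theorem window_at_one : (19 / 10 : ℝ) * (1 + Real.exp (6 * (1 : ℝ) - 3)) ≤ 2 * Real.exp (6 * (1 : ℝ) - 3) := by
  have e : Real.exp (6 * (1 : ℝ) - 3) = Real.exp 3 := by norm_num
  rw [e]
  linarith [nineteen_lt_exp_three]

open Classical in
/-- **THE μ-PART RATE FAMILY, DECIDED AT THE FULL RATE**: at `(L, r₁) = (5, 1)` and source radius `19∕10` the μ-END's bound is BELOW
W85's number `(K₀∕2)·e^{−3}` (which W85 reached at rate `½` only for radius `≤ 1`), and the bounded quantity is LIVE at `t = 19∕10`;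
every `M`, `0 < r`, `k`. [folklore] -/
example (hr0 : 0 < r) (k : ℕ) :
    ‖locE (TTouch (d := 4) (N := 5 * M)) (fun Z : (tsys 4 (5 * M)).Dom => Z.1) (actF 5 M 1 r hr k ((19 / 10 : ℝ) : ℂ)) (CR 5 M).1 -
        locE (TTouch (d := 4) (N := 5 * M)) (fun Z : (tsys 4 (5 * M)).Dom => Z.1) (actF 5 M 1 r hr k 0) (CR 5 M).1‖ ≤
      K₀ 64 8 / 2 * Real.exp (-3) ∧
    locE (TTouch (d := 4) (N := 5 * M)) (fun Z : (tsys 4 (5 * M)).Dom => Z.1) (actF 5 M 1 r hr k ((19 / 10 : ℝ) : ℂ)) (CR 5 M).1 ≠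
      locE (TTouch (d := 4) (N := 5 * M)) (fun Z : (tsys 4 (5 * M)).Dom => Z.1) (actF 5 M 1 r hr k 0) (CR 5 M).1 :=
  ⟨(towerMuEnd_fires_family_closed 5 M 1 r hr (by norm_num) zero_le_one le_rfl k (μ₀ := 19 / 10) (by norm_num) (by norm_num)
      (by rw [Complex.norm_real]; norm_num)).trans
      ((rate_buys_window_iff 1 (by norm_num) (by norm_num)).2 window_at_one),
    towerMuEnd_family_live 5 M 1 r hr (by norm_num) zero_le_one le_rfl hr0 k (by norm_num) (by norm_num)⟩

end MuFamily

/-! ## §4 (v1.2) COMPLEX-SOURCE LIVENESS ON THE TOWER through W100's pencil injectivity (`DressedSmallFieldPencilInjective`, leaf-09 g15):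
the family's activity at the rod IS `c·pencil r s` — W100's one-cube pencil term — so two DISTINCT COMPLEX sources of the disc `‖s‖ ≤ ρ`,
`2ρr < 1` (`ρ ≤ 2`), give DIFFERENT dressed outputs at `C_R`; §2's `towerMuEnd_family_live` is the real pair `(t, 0)`, radius-free -/

section Complex
variable (L M : ℕ) [NeZero L] [NeZero M] (r₁ : ℝ) (r : ℝ) (hr : 0 ≤ r)

/-- **THE FAMILY's ACTIVITY AT THE ROD IS W100's PENCIL TERM**: `actF … k s (C_R) = ((cM r∕2)·e^{−5r₁}·(ε³ + v(r₁)³))·pencil r s`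
(W94 `actF_CR`; W100's `pencil r s` is the same integral, by `rfl`). [folklore] -/
theorem actF_CR_eq_pencil (hL : 5 ≤ L) (k : ℕ) (s : ℂ) :
    actF L M r₁ r hr k s (CR L M) = ((cM r / 2 * Real.exp (-(5 * r₁)) * (εN L ^ 3 + vF r₁ ^ 3) : ℝ) : ℂ) * pencil r s := by
  rw [actF_CR L M r₁ r hr hL]; rfl

open Classical in
/-- **COMPLEX-SOURCE LIVENESS OF THE μ-END's QUANTITY AT EVERY RATE `0 ≤ r₁ ≤ 1`** [decided toy]: for `0 < r`, two DISTINCT complex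
sources `s ≠ s′` with `‖s‖, ‖s′‖ ≤ ρ ≤ 2` and `2ρr < 1` give `E_{act s}(C_R) ≠ E_{act s′}(C_R)` — §2's `exp_locE_actF` turns equal outputs
into equal activities at the rod, `actF_CR_eq_pencil` + W94's `massF_pos` ∕ W35's `cM_pos` strip the positive constant, and W100's
`pencil_injOn` forbids `pencil r s = pencil r s′`.  The radius `2ρr < 1` is W100's METHOD's (sufficient only); §2's real-pair liveness is
radius-free and not superseded. [folklore] -/
theorem towerMuEnd_family_live_complex (hL : 5 ≤ L) (h0 : 0 ≤ r₁) (h1 : r₁ ≤ 1) (hr0 : 0 < r) (k : ℕ) {ρ : ℝ} (hρ2 : ρ ≤ 2)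
    (h2 : 2 * ρ * r < 1) {s s' : ℂ} (hs : ‖s‖ ≤ ρ) (hs' : ‖s'‖ ≤ ρ) (hne : s ≠ s') :
    locE (TTouch (d := 4) (N := L * M)) (fun Z : (tsys 4 (L * M)).Dom => Z.1) (actF L M r₁ r hr k s) (CR L M).1 ≠
      locE (TTouch (d := 4) (N := L * M)) (fun Z : (tsys 4 (L * M)).Dom => Z.1) (actF L M r₁ r hr k s') (CR L M).1 := by
  intro h
  have h' := congrArg cexp h
  rw [exp_locE_actF L M r₁ r hr hL h0 h1 k (hs.trans hρ2), exp_locE_actF L M r₁ r hr hL h0 h1 k (hs'.trans hρ2), add_right_inj,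
    actF_CR_eq_pencil L M r₁ r hr hL, actF_CR_eq_pencil L M r₁ r hr hL] at h'
  have hc : ((cM r / 2 * Real.exp (-(5 * r₁)) * (εN L ^ 3 + vF r₁ ^ 3) : ℝ) : ℂ) ≠ 0 := by
    exact_mod_cast (mul_pos (mul_pos (half_pos (cM_pos r)) (Real.exp_pos _)) (massF_pos L r₁ h1)).ne'
  exact hne (pencil_injOn r hr0 ((norm_nonneg s).trans hs) h2 (mem_closedBall_zero_iff.2 hs) (mem_closedBall_zero_iff.2 hs')
    (mul_left_cancel₀ hc h'))

open Classical in
/-- **… in `↔` form** on the disc: `E_{act s}(C_R) = E_{act s′}(C_R) ↔ s = s′` — the tower's dressed output at the rod DETERMINES the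
complex source (every rate `0 ≤ r₁ ≤ 1`). [folklore] -/
theorem towerMuEnd_family_eq_iff (hL : 5 ≤ L) (h0 : 0 ≤ r₁) (h1 : r₁ ≤ 1) (hr0 : 0 < r) (k : ℕ) {ρ : ℝ} (hρ2 : ρ ≤ 2)
    (h2 : 2 * ρ * r < 1) {s s' : ℂ} (hs : ‖s‖ ≤ ρ) (hs' : ‖s'‖ ≤ ρ) :
    locE (TTouch (d := 4) (N := L * M)) (fun Z : (tsys 4 (L * M)).Dom => Z.1) (actF L M r₁ r hr k s) (CR L M).1 =
        locE (TTouch (d := 4) (N := L * M)) (fun Z : (tsys 4 (L * M)).Dom => Z.1) (actF L M r₁ r hr k s') (CR L M).1 ↔ s = s' :=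
  ⟨fun h => by_contra fun hne => towerMuEnd_family_live_complex L M r₁ r hr hL h0 h1 hr0 k hρ2 h2 hs hs' hne h, fun h => by rw [h]⟩

open Classical in
/-- THE μ-END AND ITS COMPLEX LIVENESS TOGETHER, DECIDED: at `(L, r₁, r) = (5, 1, 1∕4)`, window `μ₀ = 1`, the bound `(K₀∕2)e^{−6}·1∕(2−1)`
holds at the NON-REAL source `I` AND the quantity it bounds is NOT zero there (`ρ = 1`: `2·1·¼ < 1`). [folklore] -/
example (k : ℕ) :
    ‖locE (TTouch (d := 4) (N := 5 * M)) (fun Z : (tsys 4 (5 * M)).Dom => Z.1) (actF 5 M 1 (1 / 4) (by norm_num) k Complex.I) (CR 5 M).1 -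
        locE (TTouch (d := 4) (N := 5 * M)) (fun Z : (tsys 4 (5 * M)).Dom => Z.1) (actF 5 M 1 (1 / 4) (by norm_num) k 0) (CR 5 M).1‖ ≤
      K₀ 64 8 / 2 * Real.exp (-(6 * 1)) * (1 / (2 - 1)) ∧
    locE (TTouch (d := 4) (N := 5 * M)) (fun Z : (tsys 4 (5 * M)).Dom => Z.1) (actF 5 M 1 (1 / 4) (by norm_num) k Complex.I) (CR 5 M).1 ≠
      locE (TTouch (d := 4) (N := 5 * M)) (fun Z : (tsys 4 (5 * M)).Dom => Z.1) (actF 5 M 1 (1 / 4) (by norm_num) k 0) (CR 5 M).1 :=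
  ⟨towerMuEnd_fires_family_closed 5 M 1 (1 / 4) (by norm_num) (by norm_num) zero_le_one le_rfl k one_pos one_lt_two
      (by rw [Complex.norm_I]),
    towerMuEnd_family_live_complex 5 M 1 (1 / 4) (by norm_num) (by norm_num) zero_le_one le_rfl (by norm_num) k (ρ := 1) (by norm_num)
      (by norm_num) (by rw [Complex.norm_I]) (by simp) Complex.I_ne_zero⟩

end Complex

end Summit.QuantumFields.BalabanUV.T4Continuum.NE1p.DressedSmallFieldNestedToriTower

end
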